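import Summits.BirchSwinnertonDyer.BirchSwinnertonDyer.Theorems.SemiOrdinaryEisensteinDescentWildSplitEisensteinValueAtOneVVisible371682b1Partner
import Summits.BirchSwinnertonDyer.Rank1Residual.GaloisImage.CongruenceVisibilityIdentityComponentRat
import HarnessLib

/-!
# Route `SemiOrdinaryEisensteinDescent`, crux #2″ `WildSplitEisensteinValueAtOneV` (E_𝟙^V, stmt-BirchSwinnertonDyer-26610):
# the ℚ-level content row `371682b1` — the LOWER HALF `ord₃ #Ш_an ≤ ord₃ #Ш` at `3` from a VISIBLE element of `Ш[3]`
# (the 3-congruent RANK-3 partner `13766a1`), with the partner's rank, the bad places and all local kinds decided IN THE KERNEL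
# (cell `pub/bsd-wall`, width seat `bsd-wall-soed-p1-w3` g20; `--supports stmt-BirchSwinnertonDyer-26610`; THEOREMS ONLY; Theses-FREE)

WHY. Modulo the print binders and the rank-zero leaf Z of the route's `closes`, crux #2″ is, statement for statement,
«`Typed.MissingLowerBoundAt W 3` for every cell curve `W` (ClassO6 at `3`, `ρ̄₃` onto, `r_an = 1`)» (w3 g14,
`Theorems/SemiOrdinaryEisensteinDescentWildSplitEisensteinValueAtOneVLowerHalf.lean`). In Cremona's range the cell has 3 894 classes and
exactly NINE carry content (`3 ∣ #Ш(E/ℚ)_an`, all with `#Ш_an = 9`); this seat found that every one of them is congruent modulo `3` to a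
curve of Mordell–Weil rank `3` at a LOWER `3`-level (memo `Cruxes/WildSplitEisensteinInclusionAtThree/E1V-VISIBLE-NINE-w3g20.md`). This file
is the kernel record for the cleanest pair:

* `E = 371682b1 = [1, −1, 0, −13110, −631468]` (`N = 2·3³·6883`, `Δ = −2⁵·3⁹·6883²`, `r_an = 1`, `#Ш_an = 9`, `E(ℚ)_tors = 1`,
  ClassO6 at `3`, `ρ̄₃` onto — a member of the rung's cell);
* `F = 13766a1 = [1, 0, 1, −23, 42]` (`N′ = 2·6883 = N/27`, `Δ′ = −2⁴·6883`, rank `3`, generators `(3,0)`, `(−1,8)`, `(2,1)`);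
  `a_ℓ(E) ≡ a_ℓ(F) (mod 3)` at all 76 primes `5 ≤ ℓ ≤ 400`, `ℓ ≠ 6883` (seat census; `j(E) ≠ j(F)`), i.e. `E[3] ≅ F[3]` — the datum `θ`.

THE CERTIFICATE (tree door `VisibleLowerHalf.missingLowerBoundAt_of_congr_of_places_of_analyticRank_one`, p538812-style, `p = 3`):
`S = {v₂, v₃, v₆₈₈₃}` (outside `S` both curves are good and `v ∤ 3`); the place `v₃` is PAID (`E` is additive above `p`, so no free kind
exists there): cost `#F(ℚ₃)[3]·#(ℤ₃/3) = 1·3`, so the count reads `3^{rank E} · 3 = 9 < 27 ≤ 3^{rank F}` — this is why a partner of rank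
THREE is needed; `v₂`: both curves multiplicative, `γ(E)/γ(F) = −296193125/7319039139` a `2`-adic unit square, `μ₃(ℚ₂) = 1` (kind (iii));
`v₆₈₈₃`: `#F(ℚ₆₈₈₃)[3] = 1` (kind (i)). DECIDED HERE, in the kernel: `3 ≤ rank F(ℚ)` (the tree's `3`-descent certificate
`Rank2.linearIndependent_triple_of_three_descent` on the three generators, reductions at `7, 11, 17`, no `3`-torsion by `13`), the bad places,
the three local kinds (deciders `LocalTorsion3.threeTorsionCheck` at `v₃`, `LocalTorsion3At.threeTorsionCheckAt` at `v₆₈₈₃`, `sqFlagAt` at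
`v₂`), `E(ℚ)_tors` prime to `3` (`#Ẽ(𝔽₁₃) = 8`), and the global minimality of `E` (Kraus). WHAT STAYS DATA: `r_an(E) = 1` (`hr`),
`#Ш(E)_an = q` with `ord₃ q ≤ 2` (`hq`, `hv`; attested `q = 9`, Cremona `allbsd`), and the `Γ_ℚ`-isomorphism `θ : F[3] ⥲ E[3]` (`θ`, `hθ`;
to be certified by a stabilised Sturm test at level `2·3³·6883`, as bsd-stepL's kit j280667 did for its pair) — the same evidence tier as
`ErratumRoadFiveRest3DWitnessD1VisibleKernel.lean`, whose pattern this file follows. Published binders: Cassels–Tate (`hCT`), GZK (`hGZK`),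
Tate uniformisation (`hU`, `hU2`).

HONEST FRAMING: CONDITIONAL on the displayed published facts and data; ONE curve; BSD₃ at `371682b1` is NOT claimed (the upper half is the
Kolyvagin column's); crux #2″ is NOT advanced class-wide by this (no theorem supplies rank-3 partners); nothing booked. BSD is not proved.

References: [CremonaMazur2000] §3, Table 1; [AgasheStein2002] Thm. 3.1; [SilvermanAEC2009] III.1, VII.2.1, VII.3.1, VII.5.1, VIII.6.7,
X.4.14; [SilvermanATAEC1994] V.5.3–5.4; [Serre1973] II.3.3; [Kraus1989]; [Knapp1993] V Thm. 5.1(c); [Miller2011LMS] Def. 1.1;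
[Cremona1997] Table 1 (13766a1); Cremona's `ecdata` (371682b1, allbsd/allgens).
-/

-- the Theorems namespace of this sub repeats the summit name by design (D-0017 nested layout)
set_option linter.dupNamespace false
set_option autoImplicit false

noncomputable section

open scoped Classical

open WeierstrassCurve IsDedekindDomain NumberField Rat.HeightOneSpectrum
  Literature.NumberTheory.EllipticCurves Literature.NumberTheory.EllipticCurves.Rank1Residual
  Literature.NumberTheory.EllipticCurves.Rank1Residual.Typed
  Literature.NumberTheory.EllipticCurves.Rank1Residual.X11RankOneCertificates
  Summit.BirchSwinnertonDyer.BirchSwinnertonDyer.Rank1Residual.IntModel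
  Summit.BirchSwinnertonDyer.Rank1Residual Summit.BirchSwinnertonDyer.Rank1Residual.X11b
  Summit.BirchSwinnertonDyer.Rank1Residual.Supersingular
  Summit.BirchSwinnertonDyer.Rank1Residual.GaloisImage
  Summit.BirchSwinnertonDyer.Rank2

namespace Summit.BirchSwinnertonDyer.BirchSwinnertonDyer.Theorems

namespace Visible371682b1

open VisiblePlaces D1VisibleKernel

/-! ## §2 The curve `E = 371682b1 = [1, −1, 0, −13110, −631468]`: model, minimality, no rational `3`-torsion -/

/-- `Δ(E) = −29839861970784 = −2⁵·3⁹·6883²`. [folklore] -/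
theorem E_Δ : (⟨1, -1, 0, -13110, -631468⟩ : WeierstrassCurve ℤ).Δ = -29839861970784 := by decide

/-- The factorisation `Δ(E) = −2⁵·3⁹·6883²`. [folklore] -/
theorem E_Δ_factor : (⟨1, -1, 0, -13110, -631468⟩ : WeierstrassCurve ℤ).Δ = -(2 ^ 5 * 3 ^ 9 * 6883 ^ 2) := by
  rw [E_Δ]; norm_num

/-- `c₄(E) = 629289 = 3⁴·7769` (odd, prime to `6883`). [folklore] -/
theorem E_c₄ : (⟨1, -1, 0, -13110, -631468⟩ : WeierstrassCurve ℤ).c₄ = 629289 := by decide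

/-- The rational model of `E` is the base change of the integer one. [folklore] -/
theorem E_map_eq : (⟨1, -1, 0, -13110, -631468⟩ : WeierstrassCurve ℤ).map (Int.castRingHom ℚ) =
    (⟨1, -1, 0, -13110, -631468⟩ : WeierstrassCurve ℚ) := by
  ext <;> simp [WeierstrassCurve.map]

/-- The same in `baseChange` form. [folklore] -/
theorem E_baseChange_eq : (⟨1, -1, 0, -13110, -631468⟩ : WeierstrassCurve ℤ).baseChange ℚ = (⟨1, -1, 0, -13110, -631468⟩ : WeierstrassCurve ℚ) :=
  E_map_eq

/-- `E/ℚ` is an elliptic curve. [folklore] -/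
theorem isElliptic_E : (⟨1, -1, 0, -13110, -631468⟩ : WeierstrassCurve ℚ).IsElliptic :=
  isElliptic_of_discOf_ne_zero 1 (-1) 0 (-13110) (-631468) (by decide +kernel)

/-- **The Cremona model of `E` is globally minimal**: complete factorisation `|Δ| = 2⁵·3⁹·6883²` kernel-checked, every exponent `< 12`
(Kraus ∕ Silverman VII.1 Rem. 1.1; tree `isGloballyMinimal_of_krausCriterion₃_factored`). [cite: SilvermanAEC2009, VII.1 Remark 1.1]
[cite: Kraus1989, Prop. 1 and Prop. 2] -/
theorem isGloballyMinimal_E : (⟨1, -1, 0, -13110, -631468⟩ : WeierstrassCurve ℚ).IsGloballyMinimal :=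
  isGloballyMinimal_of_krausCriterion₃_factored 1 (-1) 0 (-13110) (-631468)
    [(2, 5), (3, 9), (6883, 2)] (by decide +kernel)
    (by intro qe hqe; simp only [List.mem_cons, List.not_mem_nil, or_false] at hqe
        rcases hqe with rfl | rfl | rfl <;> norm_num)
    (by intro qe hqe; simp only [List.mem_cons, List.not_mem_nil, or_false] at hqe
        rcases hqe with rfl | rfl | rfl <;> exact Or.inl (by decide +kernel))

/-- `#Ẽ(𝔽₁₃) = 8` (kernel-decided; prime to `3`). [folklore] -/
theorem card_E_13 : Nat.card (((⟨1, -1, 0, -13110, -631468⟩ : WeierstrassCurve ℤ).map (Int.castRingHom (ZMod 13))).toAffine.Point) = 8 := by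
  rw [@WeierstrassCurve.natCard_point_eq_one_add_card (ZMod 13) (@ZMod.instField 13 ⟨by norm_num⟩) _ _ _
    (by decide +kernel), @card_sol_eq_sum_euler (ZMod 13) (@ZMod.instField 13 ⟨by norm_num⟩) _ _
    (by rw [ZMod.ringChar_zmod_n]; decide), ZMod.card]
  decide +kernel

/-- **`gcd(#E(ℚ)_tors, 3) = 1`**: `#E(ℚ)_tors ∣ #Ẽ(𝔽₁₃) = 8` (Knapp V Thm. 5.1(c), tree `torsionOrder_dvd_natCard_point_map_zmod`, integer
model, `13 ∤ Δ`). [cite: Knapp1993, Ch. V §1 Thm. 5.1(c)] -/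
theorem coprime_torsionOrder_E [(⟨1, -1, 0, -13110, -631468⟩ : WeierstrassCurve ℚ).IsElliptic] :
    ((⟨1, -1, 0, -13110, -631468⟩ : WeierstrassCurve ℚ).torsionOrder).Coprime 3 := by
  haveI : Fact (Nat.Prime 13) := ⟨by norm_num⟩
  haveI : (⟨1, -1, 0, -13110, -631468⟩ : WeierstrassCurve ℚ).IsIntegral ℤ :=
    ⟨⟨(⟨1, -1, 0, -13110, -631468⟩ : WeierstrassCurve ℤ), E_baseChange_eq.symm⟩⟩
  have h := LutzNagellGeneral.torsionOrder_dvd_natCard_point_map_zmod 13 (⟨1, -1, 0, -13110, -631468⟩ : WeierstrassCurve ℚ)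
    (⟨1, -1, 0, -13110, -631468⟩ : WeierstrassCurve ℤ) E_baseChange_eq (Or.inl (by norm_num)) (by rw [E_Δ]; norm_num)
  rw [card_E_13] at h
  exact Nat.Coprime.coprime_dvd_left h (by norm_num)

/-! ## §3 The local kinds at `S = {v₂, v₃, v₆₈₈₃}` and good reduction outside `S` -/

/-- `Δ(F) ≠ 0` on the integer model. [folklore] -/
theorem F_Δ_ne_zero : (⟨1, 0, 1, -23, 42⟩ : WeierstrassCurve ℤ).Δ ≠ 0 := by rw [F_Δ]; decide

/-- `Δ(E) ≠ 0` on the integer model. [folklore] -/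
theorem E_Δ_ne_zero : (⟨1, -1, 0, -13110, -631468⟩ : WeierstrassCurve ℤ).Δ ≠ 0 := by rw [E_Δ]; decide

/-- `3 ∉ v` at the place above a prime `ℓ ≠ 3`. [folklore] -/
theorem three_not_mem_placeAbove {ℓ : ℕ} (hℓ : ℓ.Prime) (h3 : ℓ ≠ 3) :
    ((3 : ℕ) : 𝓞 ℚ) ∉ ((primesEquiv (R := 𝓞 ℚ)).symm ⟨ℓ, hℓ⟩).asIdeal := by
  rw [Nat.cast_ofNat, show (3 : 𝓞 ℚ) = ((3 : ℕ) : 𝓞 ℚ) by norm_num,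
    natCast_mem_asIdeal_iff_eq_placeAbove _ (by norm_num : (3 : ℕ).Prime)]
  intro h
  have := congrArg natGenerator h
  rw [natGenerator_placeAbove, natGenerator_placeAbove] at this
  exact h3 this

/-- **The PAID place `v₃`: `#F(ℚ₃)[3] = 1` IN THE KERNEL** (decider `LocalTorsion3.threeTorsionCheck`, precision `k = 1`, empty
certificate: `Ψ₃(F)` has no root modulo `3`; `F` has good supersingular reduction at `3`, `#F̃(𝔽₃) = 6` but the point of order `3`
does not lift). [cite: SilvermanAEC2009, VII.3.1 and Ex. 3.7] -/
theorem natCard_ker_three_F_at_3 :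
    Nat.card (nsmulAddMonoidHom 3 : (((⟨1, 0, 1, -23, 42⟩ : WeierstrassCurve ℚ)).baseChange
      (((primesEquiv (R := 𝓞 ℚ)).symm ⟨3, by norm_num⟩).adicCompletion ℚ)).toAffine.Point →+ _).ker = 1 :=
  LocalTorsion3.natCard_ker_nsmul_three_adicCompletion_eq_one_of_check 1 0 1 (-23) 42 F_Δ_ne_zero
    (k := 1) (cert := []) (by decide +kernel) _ (by norm_num) (primesEquiv_placeAbove 3 (by norm_num))

/-- **Kind (i) at `v₆₈₈₃`: `3 ∉ v₆₈₈₃` and `#F(ℚ₆₈₈₃)[3] = 1` IN THE KERNEL** (decider `LocalTorsion3At.threeTorsionCheckAt`, precision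
`k = 1`, one Hensel ball `(c, m, N, w) = (143692055913, 0, 2, 0)` with `g(c)` a non-square unit: `F` is non-split multiplicative at
`6883 ≡ 1 (mod 3)`). [cite: SilvermanAEC2009, VII.3.1 and Ex. 3.7] -/
theorem kind_i_F_at_6883 :
    ((3 : ℕ) : 𝓞 ℚ) ∉ ((primesEquiv (R := 𝓞 ℚ)).symm ⟨6883, by norm_num⟩).asIdeal ∧
    Nat.card (nsmulAddMonoidHom 3 : (((⟨1, 0, 1, -23, 42⟩ : WeierstrassCurve ℚ)).baseChange
      (((primesEquiv (R := 𝓞 ℚ)).symm ⟨6883, by norm_num⟩).adicCompletion ℚ)).toAffine.Point →+ _).ker = 1 := by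
  haveI : Fact (Nat.Prime 6883) := ⟨by norm_num⟩
  exact LocalTorsion3At.free_kind_i_of_checkAt 6883 1 0 1 (-23) 42 (by norm_num) F_Δ_ne_zero
    (k := 1) (cert := [((143692055913 : ℤ), 0, 2, 0)]) (by decide +kernel) _ (by norm_num) (primesEquiv_placeAbove 6883 (by norm_num))

/-- `γ(E) = −c₄/c₆ = −7769/6770619` over `ℚ` (`c₄ = 629289`, `c₆ = 548420139`). [folklore] -/
theorem gamma_E : -(((⟨1, -1, 0, -13110, -631468⟩ : WeierstrassCurve ℚ)).c₄ / ((⟨1, -1, 0, -13110, -631468⟩ : WeierstrassCurve ℚ)).c₆) =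
    -((7769 : ℚ) / 6770619) := by
  norm_num [WeierstrassCurve.c₄, WeierstrassCurve.c₆, WeierstrassCurve.b₂, WeierstrassCurve.b₄, WeierstrassCurve.b₆]

/-- `γ(F) = −c₄/c₆ = 1081/38125` over `ℚ` (`c₄ = 1081`, `c₆ = −38125`). [folklore] -/
theorem gamma_F : -(((⟨1, 0, 1, -23, 42⟩ : WeierstrassCurve ℚ)).c₄ / ((⟨1, 0, 1, -23, 42⟩ : WeierstrassCurve ℚ)).c₆) =
    (1081 : ℚ) / 38125 := by
  norm_num [WeierstrassCurve.c₄, WeierstrassCurve.c₆, WeierstrassCurve.b₂, WeierstrassCurve.b₄, WeierstrassCurve.b₆]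

/-- **Kind (iii) at `v₂`, IN THE KERNEL**: both `E` and `F` are multiplicative at `v₂` (`2 ∣ Δ`, `2 ∤ c₄` on the integer models),
`γ(E)/γ(F) = −296193125/7319039139` is a `2`-adic unit square (`N·D ≡ 1 (mod 8)`, `sqFlagAt 2`), and `μ₃(ℚ₂) = 1` (`−3` is not a square in
`ℚ₂`). [cite: SilvermanATAEC1994, Ch. V Thm. 5.3, Cor. 5.4] [cite: Serre1973, Ch. II §3.3] -/
theorem kind_iii_E_F_at_2 [(⟨1, -1, 0, -13110, -631468⟩ : WeierstrassCurve ℚ).IsElliptic] [(⟨1, 0, 1, -23, 42⟩ : WeierstrassCurve ℚ).IsElliptic] :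
    ((⟨1, -1, 0, -13110, -631468⟩ : WeierstrassCurve ℚ)).HasMultiplicativeReductionAt ((primesEquiv (R := 𝓞 ℚ)).symm ⟨2, by norm_num⟩) ∧
    ((⟨1, 0, 1, -23, 42⟩ : WeierstrassCurve ℚ)).HasMultiplicativeReductionAt ((primesEquiv (R := 𝓞 ℚ)).symm ⟨2, by norm_num⟩) ∧
    (∃ r : ((primesEquiv (R := 𝓞 ℚ)).symm ⟨2, by norm_num⟩).adicCompletion ℚ,
      algebraMap ℚ _ (-(((⟨1, -1, 0, -13110, -631468⟩ : WeierstrassCurve ℚ)).c₄ / ((⟨1, -1, 0, -13110, -631468⟩ : WeierstrassCurve ℚ)).c₆)) =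
        r ^ 2 * algebraMap ℚ _ (-(((⟨1, 0, 1, -23, 42⟩ : WeierstrassCurve ℚ)).c₄ / ((⟨1, 0, 1, -23, 42⟩ : WeierstrassCurve ℚ)).c₆))) ∧
    (∀ ζ : ((primesEquiv (R := 𝓞 ℚ)).symm ⟨2, by norm_num⟩).adicCompletion ℚ, ζ ^ 3 = 1 → ζ = 1) := by
  haveI : Fact (Nat.Prime 2) := ⟨by norm_num⟩
  haveI : ((⟨1, -1, 0, -13110, -631468⟩ : WeierstrassCurve ℤ).baseChange ℚ).IsElliptic := by rw [E_baseChange_eq]; infer_instance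
  haveI : ((⟨1, 0, 1, -23, 42⟩ : WeierstrassCurve ℤ).baseChange ℚ).IsElliptic := by rw [F_baseChange_eq]; infer_instance
  refine ⟨?_, ?_, ?_, LocalTorsion3At.forall_pow_three_eq_one_adicCompletion_of_sqFlagAt _ (primesEquiv_placeAbove 2 (by norm_num))
    (w₃ := 0) (by norm_num) (by norm_num) (by decide +kernel)⟩
  · have h := hasMultiplicativeReductionAt_baseChange_int_of_dvd_of_not_dvd (⟨1, -1, 0, -13110, -631468⟩ : WeierstrassCurve ℤ)
      ((primesEquiv (R := 𝓞 ℚ)).symm ⟨2, by norm_num⟩) (by rw [natGenerator_placeAbove, E_Δ]; decide)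
      (by rw [natGenerator_placeAbove, E_c₄]; decide)
    rwa [E_baseChange_eq] at h
  · have h := hasMultiplicativeReductionAt_baseChange_int_of_dvd_of_not_dvd (⟨1, 0, 1, -23, 42⟩ : WeierstrassCurve ℤ)
      ((primesEquiv (R := 𝓞 ℚ)).symm ⟨2, by norm_num⟩) (by rw [natGenerator_placeAbove, F_Δ]; decide)
      (by rw [natGenerator_placeAbove, F_c₄]; decide)
    rwa [F_baseChange_eq] at h
  · rw [gamma_E, gamma_F]
    exact LocalTorsion3At.exists_eq_sq_mul_of_sqFlagAt _ (primesEquiv_placeAbove 2 (by norm_num)) (by norm_num)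
      (N := -296193125) (D := 7319039139) (by norm_num) (by norm_num)
      (w := 0) (by norm_num) (by decide +kernel) (by decide +kernel)

/-- Outside `{v₂, v₃, v₆₈₈₃}` the prime below `v` is none of `2, 3, 6883`. [folklore] -/
theorem natGenerator_ne_of_not_mem_places {v : HeightOneSpectrum (𝓞 ℚ)} (hv : v ∉ ({(primesEquiv (R := 𝓞 ℚ)).symm ⟨2, by norm_num⟩,
        (primesEquiv (R := 𝓞 ℚ)).symm ⟨3, by norm_num⟩, (primesEquiv (R := 𝓞 ℚ)).symm ⟨6883, by norm_num⟩} : Finset (HeightOneSpectrum (𝓞 ℚ)))) :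
    natGenerator v ≠ 2 ∧ natGenerator v ≠ 3 ∧ natGenerator v ≠ 6883 := by
  simp only [Finset.mem_insert, Finset.mem_singleton, not_or] at hv
  obtain ⟨h2, h3, h6883⟩ := hv
  exact ⟨fun h ↦ h2 (eq_placeAbove_of_natGenerator_eq (by norm_num) h),
    fun h ↦ h3 (eq_placeAbove_of_natGenerator_eq (by norm_num) h),
    fun h ↦ h6883 (eq_placeAbove_of_natGenerator_eq (by norm_num) h)⟩

/-- **Outside `{v₂, v₃, v₆₈₈₃}` both `E` and `F` have good reduction and `v ∤ 3`**: `Δ(E) = −2⁵·3⁹·6883²` and `Δ(F) = −2⁴·6883` have no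
prime factor outside `{2, 3, 6883}`. [cite: SilvermanAEC2009, VII.5 Prop. 5.1(a)] -/
theorem good_outside_places (v : HeightOneSpectrum (𝓞 ℚ)) (hv : v ∉ ({(primesEquiv (R := 𝓞 ℚ)).symm ⟨2, by norm_num⟩,
        (primesEquiv (R := 𝓞 ℚ)).symm ⟨3, by norm_num⟩, (primesEquiv (R := 𝓞 ℚ)).symm ⟨6883, by norm_num⟩} : Finset (HeightOneSpectrum (𝓞 ℚ)))) :
    ((⟨1, -1, 0, -13110, -631468⟩ : WeierstrassCurve ℚ)).HasGoodReductionAt v ∧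
    ((⟨1, 0, 1, -23, 42⟩ : WeierstrassCurve ℚ)).HasGoodReductionAt v ∧
    ((3 : ℕ) : 𝓞 ℚ) ∉ v.asIdeal := by
  obtain ⟨h2, h3, h6883⟩ := natGenerator_ne_of_not_mem_places hv
  have hp : (natGenerator v).Prime := prime_natGenerator v
  have key : ∀ n : ℕ, n ∣ 2 ^ 5 * 3 ^ 9 * 6883 ^ 2 → n.Prime → n = 2 ∨ n = 3 ∨ n = 6883 := by
    intro n hn hn'
    rcases (Nat.Prime.dvd_mul hn').mp hn with h | h
    · rcases (Nat.Prime.dvd_mul hn').mp h with h | h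
      · exact Or.inl ((Nat.prime_dvd_prime_iff_eq hn' (by norm_num)).mp (hn'.dvd_of_dvd_pow h))
      · exact Or.inr (Or.inl ((Nat.prime_dvd_prime_iff_eq hn' (by norm_num)).mp (hn'.dvd_of_dvd_pow h)))
    · exact Or.inr (Or.inr ((Nat.prime_dvd_prime_iff_eq hn' (by norm_num)).mp (hn'.dvd_of_dvd_pow h)))
  have hnot : ¬ (natGenerator v ∣ 2 ^ 5 * 3 ^ 9 * 6883 ^ 2) := by
    intro h
    rcases key _ h hp with h | h | h
    · exact h2 h
    · exact h3 h
    · exact h6883 h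
  refine ⟨?_, ?_, ?_⟩
  · have h := hasGoodReductionAt_baseChange_int_of_not_dvd (⟨1, -1, 0, -13110, -631468⟩ : WeierstrassCurve ℤ) v (by
      rw [E_Δ]
      intro h
      apply hnot
      have h' : (natGenerator v : ℤ) ∣ ((2 ^ 5 * 3 ^ 9 * 6883 ^ 2 : ℕ) : ℤ) := (Int.dvd_neg.mpr h).trans (by norm_num)
      exact_mod_cast h')
    rwa [E_baseChange_eq] at h
  · have h := hasGoodReductionAt_baseChange_int_of_not_dvd (⟨1, 0, 1, -23, 42⟩ : WeierstrassCurve ℤ) v (by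
      rw [F_Δ]
      intro h
      apply hnot
      have h' : (natGenerator v : ℤ) ∣ ((2 ^ 5 * 3 ^ 9 * 6883 ^ 2 : ℕ) : ℤ) := (Int.dvd_neg.mpr h).trans (by norm_num)
      exact_mod_cast h')
    rwa [F_baseChange_eq] at h
  · rw [Nat.cast_ofNat, show (3 : 𝓞 ℚ) = ((3 : ℕ) : 𝓞 ℚ) by norm_num,
      natCast_mem_asIdeal_iff_eq_placeAbove v (by norm_num : (3 : ℕ).Prime)]
    intro h
    exact h3 (by rw [h, natGenerator_placeAbove])

end Visible371682b1

open Visible371682b1 VisiblePlaces D1VisibleKernel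

/-! ## §4 The lower half at `(371682b1, 3)` from the visible element — rank, places, paid count and kinds in the kernel -/

/-- **`ord₃ #Ш(E)_an ≤ ord₃ #Ш(E)` for `E = 371682b1` from the `3`-congruent rank-`3` partner `F = 13766a1` — KERNEL form.**
Published facts: Cassels–Tate (`hCT`), GZK (`hGZK`), Tate uniformisation (`hU`, `hU2`). DATA: `r_an(E) = 1` (`hr`), `#Ш(E)_an = q` with
`ord₃ q ≤ 2` (`hq`, `hv`; attested `q = 9`), and the `Γ_ℚ`-isomorphism `θ : F[3] ⥲ E[3]` (`θ`, `hθ`). DECIDED HERE: `3 ≤ rank F(ℚ)`, the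
bad places `{v₂, v₃, v₆₈₈₃}` with good reduction outside, the paid count at `v₃` (`#F(ℚ₃)[3]·#(ℤ₃/3) = 3`, so `3·3 < 3³`), kind (iii)
at `v₂`, kind (i) at `v₆₈₈₃`, `gcd(#E(ℚ)_tors, 3) = 1`. The tree door
`VisibleLowerHalf.missingLowerBoundAt_of_congr_of_places_of_analyticRank_one` with everything but the print binders, the analytic data
and `θ` discharged. The instance binders are discharged by `isElliptic_E`, `isGloballyMinimal_E`, `isElliptic_F`. PER PAIR; CONDITIONAL;
`MissingLowerBoundAt E 3` is the ENTIRE ℚ-level content of crux #2″ at this curve modulo the leaf Z (w3 g14 normal form); BSD₃(E) is NOT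
claimed. [cite: CremonaMazur2000, §3 and Table 1] [cite: AgasheStein2002, Thm. 3.1 and §3.5] [cite: SilvermanAEC2009, Thm. X.4.14]
[cite: SilvermanATAEC1994, Ch. V Thm. 5.3, Cor. 5.4] [cite: Miller2011LMS, Def. 1.1 (arXiv:1010.2431 p. 3)] -/
theorem missingLowerBound_371682b1_of_visibleSha_kernel
    [(⟨1, -1, 0, -13110, -631468⟩ : WeierstrassCurve ℚ).IsElliptic] [(⟨1, -1, 0, -13110, -631468⟩ : WeierstrassCurve ℚ).IsGloballyMinimal]
    [(⟨1, 0, 1, -23, 42⟩ : WeierstrassCurve ℚ).IsElliptic]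
    (hCT : exists_casselsTate_pairing (K := ℚ)) (hGZK : rank_eq_analyticRank_of_analyticRank_le_one)
    (hU : Silverman1994_thmV53_tateUniformisation.{0})
    (hU2 : Silverman1994_thmV53_corV54_tateUniformisation.{0})
    (hr : (⟨1, -1, 0, -13110, -631468⟩ : WeierstrassCurve ℚ).analyticRank = 1)
    {q : ℚ} (hq : shaAn (⟨1, -1, 0, -13110, -631468⟩ : WeierstrassCurve ℚ) = (q : ℂ)) (hv : padicValRat 3 q ≤ 2)
    (θ : geomTorsion (⟨1, 0, 1, -23, 42⟩ : WeierstrassCurve ℚ) ((3 : ℕ) : ℤ) ≃+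
      geomTorsion (⟨1, -1, 0, -13110, -631468⟩ : WeierstrassCurve ℚ) ((3 : ℕ) : ℤ))
    (hθ : ∀ (σ : Field.absoluteGaloisGroup ℚ) (P : geomTorsion (⟨1, 0, 1, -23, 42⟩ : WeierstrassCurve ℚ) ((3 : ℕ) : ℤ)),
      θ (σ • P) = σ • θ P) :
    Typed.MissingLowerBoundAt (⟨1, -1, 0, -13110, -631468⟩ : WeierstrassCurve ℚ) 3 := by
  haveI : Fact (Nat.Prime 3) := ⟨Nat.prime_three⟩
  refine VisibleLowerHalf.missingLowerBoundAt_of_congr_of_places_of_analyticRank_one _ 3 hCT hGZK hU hU2 (by norm_num) hr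
    coprime_torsionOrder_E hq hv _ θ hθ
    ({(primesEquiv (R := 𝓞 ℚ)).symm ⟨2, by norm_num⟩, (primesEquiv (R := 𝓞 ℚ)).symm ⟨3, by norm_num⟩,
      (primesEquiv (R := 𝓞 ℚ)).symm ⟨6883, by norm_num⟩} : Finset (HeightOneSpectrum (𝓞 ℚ)))
    ({(primesEquiv (R := 𝓞 ℚ)).symm ⟨3, by norm_num⟩} : Finset (HeightOneSpectrum (𝓞 ℚ)))
    (Finset.singleton_subset_iff.mpr (by simp)) good_outside_places ?_ ?_
  · -- the paid count at `v₃`: `3 · (#F(ℚ₃)[3] · #(ℤ₃/3)) = 3 · (1 · 3) = 9 < 27 ≤ 3 ^ rank F`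
    rw [Finset.prod_singleton, natCard_ker_three_F_at_3, TwistedWitness.natCard_quot_three_of_primesEquiv_eq (primesEquiv_placeAbove 3 (by norm_num))]
    calc 3 * (1 * 3) = 3 ^ 2 := by norm_num
      _ < 3 ^ 3 := by norm_num
      _ ≤ 3 ^ (⟨1, 0, 1, -23, 42⟩ : WeierstrassCurve ℚ).mordellWeilRank := Nat.pow_le_pow_right (by norm_num) three_le_rank_F
  · intro v hvS hvT
    simp only [Finset.mem_insert, Finset.mem_singleton] at hvS
    rcases hvS with rfl | rfl | rfl
    · exact Or.inr (Or.inr kind_iii_E_F_at_2)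
    · exact absurd (Finset.mem_singleton_self _) hvT
    · exact Or.inl kind_i_F_at_6883

end Summit.BirchSwinnertonDyer.BirchSwinnertonDyer.Theorems

end
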